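import Mathlib.Algebra.MvPolynomial.Basic
import Mathlib.GroupTheory.Perm.Sign
import Mathlib.Data.ZMod.Basic
import HarnessLib

/-!
# Route AnyonJets — crux `ConstantFreeJetGrowth` (stmt-ValiantsHypothesis-16738), line `birth`: objects

Definitions file for the registered line `Cruxes/ConstantFreeJetGrowth/Lines/birth.lean`, whose stubs
`stub_twoAdicShadowCongruence` and `stub_booleanSimulation` are stated over three objects the line
defines locally (its §0, "verbatim the route's inline terms"). This file puts them VERBATIM (same
names, same bodies) into an importable module so that the stubs can be proved by name in
`Theorems/`:

* `jet n k` — the `k`-th anyonic jet `J_(n,k) = Σ_σ sgn σ · C(inv σ, k) · Π_i X_(σ i, i) ∈ ℤ[x]`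
  (the route's `let J := …`, e.g. in `Theses.AnyonJets.TwoAdicShadow`);
* `shadow n k` — the truncated resummation `F_(n,k) = Σ_(j<k) (−2)^j J_(n,j)`;
* `zeroOne k y` — the 0/1 point of a Boolean matrix read in `ZMod (2^k)`.

No statement is asserted here. Honest framing: vocabulary only; the crux `ConstantFreeJetGrowth` is
OPEN (its load-bearing stub is the Boolean lower bound `stub_perModPowBooleanHard`) and nothing here
bears on `VP ≠ VNP`.
-/

set_option linter.dupNamespace false

namespace Summit.ValiantsHypothesis.ValiantsHypothesis.Theorems.AnyonJets.ConstantFreeJetGrowth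

open scoped BigOperators

noncomputable section

/-- The `k`-th ANYONIC JET `J_(n,k) = Σ_σ sgn σ · C(inv σ, k) · Π_i X_(σ i, i) ∈ ℤ[x]`
(verbatim the route's `let J := …`; `inv σ = #{(i,j) : i < j, σ j < σ i}`). [folklore] -/
noncomputable def jet (n k : ℕ) : MvPolynomial (Fin n × Fin n) ℤ :=
  ∑ σ : Equiv.Perm (Fin n), MvPolynomial.C (((Equiv.Perm.sign σ : ℤˣ) : ℤ) *
    (((Finset.univ.filter (fun p : Fin n × Fin n => p.1 < p.2 ∧ σ p.2 < σ p.1)).card.choose k : ℕ) : ℤ)) *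
    ∏ i : Fin n, MvPolynomial.X (σ i, i)

/-- The truncated resummation (2-adic shadow) `F_(n,k) = Σ_(j<k) (−2)^j J_(n,j)`; by the route's
Resummation `per_n = Σ_(j ≤ C(n,2)) (−2)^j J_(n,j)`, so `F_(n,k) ≡ per_n (mod 2^k)`. [folklore] -/
noncomputable def shadow (n k : ℕ) : MvPolynomial (Fin n × Fin n) ℤ :=
  ∑ j ∈ Finset.range k, ((-2 : ℤ) ^ j) • jet n j

/-- The 0/1 point of a Boolean matrix, read in `ZMod (2^k)`. [folklore] -/
def zeroOne (k : ℕ) {n : ℕ} (y : Fin n × Fin n → Bool) : Fin n × Fin n → ZMod (2 ^ k) :=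
  fun v => if y v then 1 else 0

end

end Summit.ValiantsHypothesis.ValiantsHypothesis.Theorems.AnyonJets.ConstantFreeJetGrowth
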